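import Summits.ResolutionOfSingularities.ResolutionOfSingularities.Theorems.UniversalCellsCampaignW82DifferentialCriterionRatFunc
import Mathlib.FieldTheory.SeparablyGenerated
import Mathlib.RingTheory.AlgebraicIndependent.Adjoin
import HarnessLib

/-!
# [OURS · L1 W8.2] THE 1-FORM CRITERION OVER A SEPARABLY GENERATED GROUND FIELD: `Ω_{K/k}` is free on
# `dx_1, …, dx_r` for a separating transcendence basis `x`, and a regular local ring essentially of finite type over
# `K` (`k` perfect) is formally smooth over `K` iff `dx_1, …, dx_r` stay linearly independent at its closed point

Cell `res-hironaka` (run/shared/lean/pub/res-hironaka/), LADDER-RESOLUTION rung L (RESCUE), slot W8.2; host route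
`UniversalCells`, host item `PrimeFieldToPerfect` (stmt-ResolutionOfSingularities-15233), door 1. Proofs file
(Theses-free), written by res-L1-s82-pv-1 (gen 7); companion of `…DifferentialCriterion` / `…RatFunc`. This is
form (E6) of Cruxes/PrimeFieldToPerfect/KERNEL.md §2 at the generality of the ORIGINAL kernel `SmoothTwist` (a
finitely generated ground field `K` of characteristic `p` and transcendence degree `r`, `p`-rank `r`): «`Y` regular is
smooth over `K` iff `dt_1 ∧ … ∧ dt_r` is nowhere zero on `Y`», with `t` a separating transcendence basis of `K` over
a perfect subfield `k` (for `K` finitely generated over `𝔽_p`: any separating transcendence basis over `𝔽_p`, which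
is also a `p`-basis).

* `exists_basis_kaehlerDifferential_of_isSeparable` — Springer 4.2.9 (ii) with the basis made explicit: if
  `x : ι → K` (finite `ι`) is algebraically independent over `k` and `K` is separable algebraic over `k(x)`, then
  `Ω_{K/k}` has a `K`-basis `b` with `b i = d(x i)` (the tree's
  `Literature.RingTheory.KrullDimension.free_and_finrank_kaehlerDifferential_of_isSeparable` records freeness and
  rank only; same proof: `K` is formally étale over `k[X_i]`).
* `exists_separating_basis_kaehlerDifferential_of_perfectField` — over a PERFECT `k`, every `K` essentially of
  finite type has a finite separating transcendence basis `x` and such a basis `b` of `Ω_{K/k}`.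
* **`formallySmooth_iff_linearIndependent_D_of_isSeparable`** — `B` local, formally smooth over `k`, `Ω_{B/k}`
  finite, `x` as above: `B` is formally smooth over `K` iff the `1 ⊗ d(x_i)` are linearly independent in
  `κ(B) ⊗ Ω_{B/k}`; **`formallySmooth_iff_linearIndependent_D_of_isRegularLocalRing`** — the same for `k` PERFECT and
  `B` REGULAR essentially of finite type over `K` (regular ⟹ formally smooth over `k`); `isSmoothAt_iff_…` at a prime.

HONEST FRAMING. OURS theorems (classical: EGA 0_IV 20.5.7 / 21.x, Springer LAG 4.2.9, assembled from Mathlib and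
the tree); NOT statements of [Hironaka2017]; nothing attributed to its author. A normal form, not progress on the
open residual. AI work, weaker than expert review; no claim beyond the kernel. No `sorry`, no new axioms.

## References (locators only)
* A. Grothendieck, *EGA 0_IV* (Publ. Math. IHÉS 20, 1964), Thm. 20.5.7 (ii).
* T. A. Springer, *Linear Algebraic Groups* (2nd ed. 1998), 4.2.9–4.2.11. [SpringerLAG1998]
-/

noncomputable section

set_option linter.dupNamespace false -- mandated namespace of this single-conjunct summit

open IsLocalRing TensorProduct KaehlerDifferential
open Literature.AlgebraicGeometry.Resolution

namespace Summit.ResolutionOfSingularities.ResolutionOfSingularities.Theorems.CampaignW82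

universe u

/-! ## §1 `Ω_{K/k}` is free on the differentials of a separating transcendence basis -/

section Basis

variable {k K : Type u} [Field k] [Field K] [Algebra k K]

open scoped IntermediateField.algebraAdjoinAdjoin in
/-- **`Ω_{K/k}` is free on `dx_1, …, dx_r` for a separating transcendence basis `x`** (Springer 4.2.9 (ii) with the
basis explicit): `x : ι → K` algebraically independent over `k` (finite `ι`), `K` separable algebraic over `k(x)`;
then there is a `K`-basis `b` of `Ω_{K/k}` with `b i = d(x i)`. (`K` is formally étale over `k[X_i]` — a
localization followed by a separable algebraic extension — so `Ω_{K/k} ≅ K ⊗ Ω_{k[X]/k}`, free on the `dX_i`.)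
[cite: SpringerLAG1998, Thm 4.2.9 (ii)] -/
theorem exists_basis_kaehlerDifferential_of_isSeparable {ι : Type*} [Fintype ι] {x : ι → K}
    (hx : AlgebraicIndependent k x)
    [hsep : Algebra.IsSeparable (IntermediateField.adjoin k (Set.range x)) K] :
    ∃ b : Module.Basis ι K Ω[K⁄k], ∀ i, b i = KaehlerDifferential.D k K (x i) := by
  -- adapted from Literature.RingTheory.KrullDimension.free_and_finrank_kaehlerDifferential_of_isSeparable
  set P := Algebra.adjoin k (Set.range x) with hP
  set E := IntermediateField.adjoin k (Set.range x) with hE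
  haveI i1 : Algebra.FormallyEtale P E :=
    Algebra.FormallyEtale.of_isLocalization (M := nonZeroDivisors P)
  haveI i2 : Algebra.FormallyEtale E K := Algebra.FormallyEtale.of_isSeparable E K
  haveI i3 : Algebra.FormallyEtale P K := Algebra.FormallyEtale.comp P E K
  -- `K` as an algebra over the polynomial ring `Q = k[X_i]`, through `aeval x : Q ≃ P ⊆ K`
  let Q := MvPolynomial ι k
  let e : Q ≃ₐ[k] P := hx.aevalEquiv
  letI : Algebra Q P := (e : Q →ₐ[k] P).toRingHom.toAlgebra
  letI : Algebra Q K := ((algebraMap P K).comp (e : Q →ₐ[k] P).toRingHom).toAlgebra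
  haveI : IsScalarTower Q P K := IsScalarTower.of_algebraMap_eq (fun q => rfl)
  haveI : IsScalarTower k Q K := IsScalarTower.of_algebraMap_eq (fun c => by
    change algebraMap k K c = algebraMap P K (e (algebraMap k Q c))
    rw [AlgEquiv.commutes]; rfl)
  have e' : Q ≃ₐ[Q] P := { e with commutes' := fun q => rfl }
  haveI : Algebra.FormallyEtale Q P := Algebra.FormallyEtale.of_equiv e'
  haveI : Algebra.FormallyEtale Q K := Algebra.FormallyEtale.comp Q P K
  have halg : ∀ i, algebraMap Q K (MvPolynomial.X i) = x i := fun i => by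
    change algebraMap P K (e (MvPolynomial.X i)) = x i
    rw [hx.algebraMap_aevalEquiv, MvPolynomial.aeval_X]
  refine ⟨(Algebra.TensorProduct.basis K (KaehlerDifferential.mvPolynomialBasis k ι)).map
    (KaehlerDifferential.tensorKaehlerEquivOfFormallyEtale k Q K), fun i => ?_⟩
  rw [Module.Basis.map_apply, Algebra.TensorProduct.basis_apply,
    KaehlerDifferential.tensorKaehlerEquivOfFormallyEtale_apply, KaehlerDifferential.mapBaseChange_tmul,
    one_smul, KaehlerDifferential.mvPolynomialBasis_apply, KaehlerDifferential.map_D, halg]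

/-- **Over a perfect field every `K` essentially of finite type has a finite separating transcendence basis `x` and
`Ω_{K/k}` is free on the `d(x_i)`** (Mathlib `exists_isTranscendenceBasis_and_isSeparable_of_perfectField` +
`exists_basis_kaehlerDifferential_of_isSeparable`). [cite: SpringerLAG1998, 4.2.9 (ii) with 4.2.10–4.2.11] -/
theorem exists_separating_basis_kaehlerDifferential_of_perfectField [PerfectField k] [Algebra.EssFiniteType k K] :
    ∃ (s : Finset K), IsTranscendenceBasis k ((↑) : s → K) ∧
      Algebra.IsSeparable (IntermediateField.adjoin k (s : Set K)) K ∧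
        ∃ b : Module.Basis s K Ω[K⁄k], ∀ i, b i = KaehlerDifferential.D k K (i : K) := by
  obtain ⟨s, hs, hsep⟩ := exists_isTranscendenceBasis_and_isSeparable_of_perfectField k K
  have hr : Set.range ((↑) : s → K) = (s : Set K) := Subtype.range_coe
  haveI : Algebra.IsSeparable (IntermediateField.adjoin k (Set.range ((↑) : s → K))) K := by rwa [hr]
  obtain ⟨b, hb⟩ := exists_basis_kaehlerDifferential_of_isSeparable hs.1
  exact ⟨s, hs, hsep, b, hb⟩

end Basis

/-! ## §2 (E6) over a separably generated ground field -/

section Criterion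

variable (k K B : Type u) [Field k] [Field K] [Algebra k K] [CommRing B] [Algebra k B] [Algebra K B]
  [IsScalarTower k K B]

/-- **The 1-form criterion over a separably generated ground field** (`x : ι → K` a finite separating
transcendence basis of `K/k`; `B` local, formally smooth over `k`, `Ω_{B/k}` finite): `B` is formally smooth over
`K` iff the 1-forms `d(x_i)` are linearly independent in `κ(B) ⊗ Ω_{B/k}` — «`dx_1 ∧ … ∧ dx_r ≠ 0` at the closed
point». [cite: EGA0IV, Thm. 20.5.7] -/
theorem formallySmooth_iff_linearIndependent_D_of_isSeparable [IsLocalRing B] {ι : Type*} [Fintype ι]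
    {x : ι → K} (hx : AlgebraicIndependent k x) [Algebra.IsSeparable (IntermediateField.adjoin k (Set.range x)) K]
    [Algebra.FormallySmooth k B] [Module.Finite B Ω[B⁄k]] :
    Algebra.FormallySmooth K B ↔
      LinearIndependent (ResidueField B)
        (fun i => (1 : ResidueField B) ⊗ₜ[B] KaehlerDifferential.D k B (algebraMap K B (x i))) := by
  obtain ⟨b, hb⟩ := exists_basis_kaehlerDifferential_of_isSeparable hx
  exact formallySmooth_iff_linearIndependent_D k K B b x hb

/-- **THE 1-FORM CRITERION FOR THE KERNEL `SmoothTwist` (form (E6), any `p`-rank)**: `k` PERFECT, `K` with a finite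
separating transcendence basis `x` over `k`, `B` a REGULAR local ring essentially of finite type over `K` (and
over `k`): `B` is formally smooth over `K` iff the `d(x_i)` are linearly independent in `κ(B) ⊗ Ω_{B/k}`.
[cite: EGA0IV, Thm. 20.5.7] -/
theorem formallySmooth_iff_linearIndependent_D_of_isRegularLocalRing [PerfectField k] {ι : Type*} [Fintype ι]
    {x : ι → K} (hx : AlgebraicIndependent k x) [Algebra.IsSeparable (IntermediateField.adjoin k (Set.range x)) K]
    [Algebra.EssFiniteType k B] [IsRegularLocalRing B] :
    Algebra.FormallySmooth K B ↔
      LinearIndependent (ResidueField B)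
        (fun i => (1 : ResidueField B) ⊗ₜ[B] KaehlerDifferential.D k B (algebraMap K B (x i))) := by
  haveI : Algebra.FormallySmooth k B := formallySmooth_of_isRegularLocalRing_of_perfectField k B
  exact formallySmooth_iff_linearIndependent_D_of_isSeparable k K B hx

end Criterion

section AtPrime

variable (k K A : Type u) [Field k] [Field K] [Algebra k K] [CommRing A] [Algebra k A] [Algebra K A]
  [IsScalarTower k K A]

/-- **(E6) at a prime, any `p`-rank**: `k` perfect, `x` a finite separating transcendence basis of `K/k`, `A`
essentially of finite type over `k` (e.g. of finite type over a finitely generated `K`), `𝔭 ⊂ A` prime with `A_𝔭`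
regular: `A` is `K`-smooth at `𝔭` iff the `d(x_i)` are linearly independent in `κ(𝔭) ⊗ Ω_{A_𝔭/k}`.
[cite: EGA0IV, Thm. 20.5.7] -/
theorem isSmoothAt_iff_linearIndependent_D_of_isRegularLocalRing [PerfectField k] {ι : Type*} [Fintype ι]
    {x : ι → K} (hx : AlgebraicIndependent k x) [Algebra.IsSeparable (IntermediateField.adjoin k (Set.range x)) K]
    [Algebra.EssFiniteType k A] (𝔭 : Ideal A) [𝔭.IsPrime] [IsRegularLocalRing (Localization.AtPrime 𝔭)] :
    Algebra.IsSmoothAt K 𝔭 ↔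
      LinearIndependent 𝔭.ResidueField
        (fun i => (1 : 𝔭.ResidueField) ⊗ₜ[Localization.AtPrime 𝔭]
          KaehlerDifferential.D k (Localization.AtPrime 𝔭) (algebraMap K (Localization.AtPrime 𝔭) (x i))) :=
  formallySmooth_iff_linearIndependent_D_of_isRegularLocalRing k K (Localization.AtPrime 𝔭) hx

end AtPrime

end Summit.ResolutionOfSingularities.ResolutionOfSingularities.Theorems.CampaignW82
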